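import Literature.ModelTheory.FiniteModelTheory.Fagin
import Literature.ModelTheory.FiniteModelTheory.CodeLayout
import Literature.Computability.Complexity.FPStringBricks
import Literature.Computability.Complexity.LengthCompare
import Literature.Computability.Complexity.UnaryLeBinary
import HarnessLib

/-!
# The verifier of an `∃SO` sentence runs in polynomial time: data complexity of first-order
logic (discharge of `ESOSentence.verifierLanguage_mem_P`, the easy direction of Fagin's theorem)

Topic `Literature/ModelTheory/FiniteModelTheory`. We prove the named fact
`Literature.ModelTheory.FiniteModelTheory.ESOSentence.verifierLanguage_mem_P` of `Fagin.lean` (Libkin 2004,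
Prop. 6.6, p. 91: "checking whether `𝔄 ⊨ Φ` can be done in time `O(‖Φ‖ × ‖𝔄‖^k)`"; proof of
Thm. 9.6, first part, p. 170; Immerman 1999, Thm. 3.1): for a non-degenerate input vocabulary `ar`
and every `Φ = ∃ S̄ ψ`, the language of pairs `⟨code of ⟨n, R⟩, table bits of W⟩` with
`(R, W) ⊨ ψ` is in the tree's class `P` (Mathlib `FinTM2`).

No machine is written: the decider is assembled in the ALGEBRA OF `FP` STRING FUNCTIONS of the
tree (`comp_mem_FP`, `fanoutFn`, `iteFn`, `iterate_mem_FP`, projections, `addFn`/`ltFn`/`norm`,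
`eqPairFn`, `unLeBinFn`, `LenEq`, `OracleCompose.midT`, and the bricks of `FPStringBricks.lean`), following the
brute-force evaluation of Libkin's Prop. 6.6:

* decoding (`xOf`, `yOf`, `uOf`, `tOf`) and the VALIDITY of an input word (well-formed pairs,
  canonical numeral, table lengths) — `valid_iff`: valid words are exactly the pairs
  `⟨code of ⟨n, R⟩, bits of W⟩`;
* unary numerics of `n` capped by the input length: `onesN` (`1ⁿ`), powers `powU a` (`1^{nᵃ}`,
  by the header arithmetic `succFn`/`mulFn` of `UnaryArithMachines.lean`), `tbU ar` (the
  number of table bits) and offsets;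
* assignments of the free variables coded as nested pairs of numerals (`codeL`), access
  `varValFn i`, extension `snocFn`, and the TABLE LOOKUP of an atom: the position
  `offset(s) + Σⱼ xⱼ nʲ` (Horner, `hornerFn`) read by `bitAtFn` — `lookupFn_spec`;
* the EVALUATOR `evalFn φ` by recursion on Mathlib's `BoundedFormula` (`falsum`, `equal`, `rel`,
  `imp`; `all` by a clocked loop over the `n` values with a binary counter and an
  `∧`-accumulator) and its correctness `evalFn_spec` (`= [decide (φ.Realize …)]` on valid words);
* the assembly `ESOSentence.verifierLanguage_mem_P_holds` (intersection of six `P` languages).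

## References

* L. Libkin, *Elements of Finite Model Theory*, Springer 2004, Prop. 6.6 (p. 91), proof of
  Thm. 9.6 (p. 170); printed pages (PDF = printed + 18 in the held copy).
* N. Immerman, *Descriptive Complexity*, Springer 1999, Thm. 3.1 (`FO ⊆ L`), Thm. 7.8.
* S. Arora, B. Barak, *Computational Complexity: A Modern Approach*, CUP 2009, §1.3.
-/

namespace Literature.ModelTheory.FiniteModelTheory

open _root_.Computability Literature.Computability.Complexity Literature.Computability.Complexity.Classes Literature.Computability.Complexity.Brick Literature.Computability.Cryptography

/-! ### Decoding an input word -/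

section Decode

/-- First component `x` (the code of the input structure; `fstP` of `PRelHierarchy.lean`).
[folklore] -/
def xOf : List Bool → List Bool := fstP
/-- Second component `y` (the table bits of the witnesses). [folklore] -/
def yOf : List Bool → List Bool := sndP
/-- The numeral `u` of the universe size. [folklore] -/
def uOf : List Bool → List Bool := fstP ∘ fstP
/-- The table bits `t` of the input relations. [folklore] -/
def tOf : List Bool → List Bool := sndP ∘ fstP
/-- The universe size `n = ⟦u⟧`. [folklore] -/
def nOf (z : List Bool) : ℕ := bitsToNat (uOf z)

/-- `xOf ∈ FP`. [folklore] -/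
theorem xOf_mem_FP : xOf ∈ FP := fstP_mem_FP
/-- `yOf ∈ FP`. [folklore] -/
theorem yOf_mem_FP : yOf ∈ FP := sndP_mem_FP
/-- `uOf ∈ FP`. [folklore] -/
theorem uOf_mem_FP : uOf ∈ FP := comp_mem_FP fstP_mem_FP fstP_mem_FP
/-- `tOf ∈ FP`. [folklore] -/
theorem tOf_mem_FP : tOf ∈ FP := comp_mem_FP sndP_mem_FP fstP_mem_FP

variable {ar wit : List ℕ}

/-- The components of a genuine pair `⟨code of ⟨n, R⟩, bits of W⟩`. [folklore] -/
theorem decode_boolPair (n : ℕ) (R : RelTables ar n) (W : RelTables wit n) :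
    xOf (boolPair (codeOf R) ((encodingRelTables wit n).encode W)) = codeOf R ∧
    yOf (boolPair (codeOf R) ((encodingRelTables wit n).encode W)) = (encodingRelTables wit n).encode W ∧
    uOf (boolPair (codeOf R) ((encodingRelTables wit n).encode W)) = encodeNat n ∧
    tOf (boolPair (codeOf R) ((encodingRelTables wit n).encode W)) = List.ofFn (relTablesEquiv ar n R) ∧
    nOf (boolPair (codeOf R) ((encodingRelTables wit n).encode W)) = n := by
  simp [xOf, yOf, uOf, tOf, nOf, fstP, sndP, codeOf_eq]

/-- VALIDITY of an input word: `z` and its first component are well-formed pairs, the numeral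
is canonical, and the two table segments have the right lengths. [folklore] -/
def Valid (ar wit : List ℕ) (z : List Bool) : Prop :=
  rePair z = z ∧ rePair (xOf z) = xOf z ∧ norm (uOf z) = uOf z ∧
    (tOf z).length = tableBits ar (nOf z) ∧ (yOf z).length = tableBits wit (nOf z)

/-- The tables of a bit string of the right length. [folklore] -/
def tablesOfBits (ar : List ℕ) (n : ℕ) (t : List Bool) (h : t.length = tableBits ar n) :
    RelTables ar n :=
  (relTablesEquiv ar n).symm fun i => t[i.1]'(by rw [h]; exact i.2)

/-- The table bits of `tablesOfBits t` are `t`. [folklore] -/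
theorem encode_tablesOfBits (ar : List ℕ) (n : ℕ) (t : List Bool) (h : t.length = tableBits ar n) :
    (encodingRelTables ar n).encode (tablesOfBits ar n t h) = t := by
  apply List.ext_getElem
  · simp [encodingRelTables, encodingBitVec, h]
  · intro i h1 h2
    simp [encodingRelTables, encodingBitVec, tablesOfBits]

/-- **Valid words are exactly the genuine pairs.** [folklore] -/
theorem valid_iff (z : List Bool) :
    Valid ar wit z ↔ ∃ (n : ℕ) (R : RelTables ar n) (W : RelTables wit n),
      boolPair (codeOf R) ((encodingRelTables wit n).encode W) = z := by
  constructor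
  · rintro ⟨hz, hx, hu, ht, hy⟩
    refine ⟨nOf z, tablesOfBits ar _ _ ht, tablesOfBits wit _ _ hy, ?_⟩
    rw [encode_tablesOfBits, codeOf, show (encodingSNPInstance ar).encode ⟨nOf z, tablesOfBits ar _ _ ht⟩
      = boolPair (encodeNat (nOf z)) ((encodingRelTables ar (nOf z)).encode (tablesOfBits ar _ _ ht)) from rfl,
      encode_tablesOfBits, nOf, ← norm_eq_encodeNat, hu]
    change boolPair (boolPair (boolUnpair (fstP z)).1 (boolUnpair (fstP z)).2) (sndP z) = z
    rw [show boolPair (boolUnpair (fstP z)).1 (boolUnpair (fstP z)).2 = rePair (xOf z) from rfl, hx]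
    exact hz
  · rintro ⟨n, R, W, rfl⟩
    obtain ⟨hx, hy, hu, ht, hn⟩ := decode_boolPair n R W
    refine ⟨rePair_boolPair _ _, by rw [hx, codeOf_eq, rePair_boolPair], by rw [hu, norm_encodeNat],
      by rw [ht, hn]; simp, by rw [hy, hn]; simp [encodingRelTables, encodingBitVec]⟩

/-- On a valid word of a non-degenerate vocabulary, `n ≤ |z|`. [folklore] -/
theorem nOf_le_length (har : IsNondegenerateVocab ar) {z : List Bool} (hz : Valid ar wit z) :
    nOf z ≤ z.length := by
  obtain ⟨n, R, W, rfl⟩ := (valid_iff z).1 hz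
  rw [(decode_boolPair n R W).2.2.2.2, length_boolPair, length_codeOf]
  have := le_tableBits_of_isNondegenerateVocab har n
  omega

end Decode

/-! ### Unary numerics of the universe size -/

section Unary

/-- `1ⁿ`, capped by the input length: `binToUnaryFn ⟨z, u⟩`. [folklore] -/
noncomputable def onesN : List Bool → List Bool := binToUnaryFn ∘ fanoutFn id uOf

/-- `onesN z = 1^{min n |z|}`. [folklore] -/
theorem onesN_eq (z : List Bool) : onesN z = ones (min (nOf z) z.length) := by
  simp [onesN, fanoutFn_apply, nOf]

/-- `onesN z = 1ⁿ` when `n ≤ |z|`. [folklore] -/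
theorem onesN_of_le {z : List Bool} (h : nOf z ≤ z.length) : onesN z = ones (nOf z) := by
  rw [onesN_eq, Nat.min_eq_left h]

/-- `onesN ∈ FP`. [folklore] -/
theorem onesN_mem_FP : onesN ∈ FP :=
  comp_mem_FP binToUnaryFn_mem_FP (fanoutFn_mem_FP OracleCompose.id_mem_FP uOf_mem_FP)

/-- The header `hdr n 0 _` of the universe size. [folklore] -/
noncomputable def hdrN : List Bool → List Bool := initFn ∘ fanoutFn onesN (fun _ => [])

/-- `hdrN z = hdr (min n |z|) 0 _`. [folklore] -/
theorem hdrN_eq (z : List Bool) :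
    hdrN z = hdr (min (nOf z) z.length) 0 (boolPair (onesN z) []) := by
  simp [hdrN, fanoutFn_apply, initFn, onesN_eq, ones]

/-- `hdrN ∈ FP`. [folklore] -/
theorem hdrN_mem_FP : hdrN ∈ FP :=
  comp_mem_FP initFn_mem_FP (fanoutFn_mem_FP onesN_mem_FP (const_mem_FP _))

/-- A fixed number of applications of `mulFn` is in `FP`. [folklore] -/
theorem iterate_mulFn_mem_FP (a : ℕ) : mulFn^[a] ∈ FP := by
  induction a with
  | zero => exact PolyTimeComputable.id (id : List Bool → List Bool)
  | succ a ih => rw [Function.iterate_succ']; exact comp_mem_FP mulFn_mem_FP ih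

/-- Iterated multiplication on headers: `mulFn^[a] (hdr n b z) = hdr n (b · nᵃ) z`. [folklore] -/
theorem iterate_mulFn_hdr (a n b : ℕ) (z : List Bool) : mulFn^[a] (hdr n b z) = hdr n (b * n ^ a) z := by
  induction a generalizing b with
  | zero => simp
  | succ a ih => rw [Function.iterate_succ_apply, mulFn_hdr, ih, pow_succ]; ring_nf

/-- `1^{nᵃ}` (capped): the second field (`OracleCompose.midT`) of `mulFn^[a] (succFn (hdrN z))`.
[folklore] -/
noncomputable def powU (a : ℕ) : List Bool → List Bool := OracleCompose.midT.eval ∘ mulFn^[a] ∘ succFn ∘ hdrN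

/-- `powU a z = 1^{mᵃ}` with `m = min n |z|`. [folklore] -/
theorem powU_eq (a : ℕ) (z : List Bool) : powU a z = ones ((min (nOf z) z.length) ^ a) := by
  simp only [powU, Function.comp_apply, hdrN_eq, succFn_hdr, iterate_mulFn_hdr, OracleCompose.midT_eval_hdr,
    Nat.zero_add, one_mul]

/-- `powU a ∈ FP`. [folklore] -/
theorem powU_mem_FP (a : ℕ) : powU a ∈ FP :=
  comp_mem_FP OracleCompose.midT.polyTimeComputable_eval
    (comp_mem_FP (iterate_mulFn_mem_FP a) (comp_mem_FP succFn_mem_FP hdrN_mem_FP))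

/-- The number of table bits of a vocabulary, in unary (capped): concatenation of the powers.
[folklore] -/
noncomputable def tbU : List ℕ → (List Bool → List Bool)
  | [] => fun _ => []
  | a :: l => fun z => powU a z ++ tbU l z

/-- `tbU l z = 1^{Σ_{a ∈ l} mᵃ}` with `m = min n |z|`. [folklore] -/
theorem tbU_eq (l : List ℕ) (z : List Bool) :
    tbU l z = ones ((l.map fun a => (min (nOf z) z.length) ^ a).sum) := by
  induction l with
  | nil => rfl
  | cons a l ih =>
    show powU a z ++ tbU l z = _
    rw [ih, powU_eq, List.map_cons, List.sum_cons]
    simp only [ones, ← List.replicate_add]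

/-- `tbU l ∈ FP`. [folklore] -/
theorem tbU_mem_FP (l : List ℕ) : tbU l ∈ FP := by
  induction l with
  | nil => rw [tbU]; exact const_mem_FP _
  | cons a l ih => rw [tbU]; exact append_mem_FP (powU_mem_FP a) ih

/-- `tableBits` as a list sum. [folklore] -/
theorem tableBits_eq_sum_map (ar : List ℕ) (n : ℕ) : tableBits ar n = (ar.map fun a => n ^ a).sum := by
  unfold tableBits
  rw [← List.sum_ofFn]
  congr 1
  exact List.ext_getElem (by simp) fun i h1 h2 => by simp

/-- `tbU ar z = 1^{tableBits ar n}` when `n ≤ |z|`. [folklore] -/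
theorem tbU_of_le (ar : List ℕ) {z : List Bool} (h : nOf z ≤ z.length) :
    tbU ar z = ones (tableBits ar (nOf z)) := by
  rw [tbU_eq, Nat.min_eq_left h, tableBits_eq_sum_map]

/-- `tableOffset` as a list sum over a prefix of the arity list. [folklore] -/
theorem tableOffset_eq_sum_take (ar : List ℕ) (n : ℕ) (s : Fin ar.length) :
    tableOffset ar n s = ((ar.take s).map fun a => n ^ a).sum := by
  have hlist : (ar.take s).map (fun a => n ^ a) =
      List.ofFn (fun i : Fin s => n ^ ar.get (Fin.castLE s.2.le i)) := by
    refine List.ext_getElem (by simp) fun i h1 h2 => ?_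
    simp only [List.getElem_map, List.getElem_take, List.getElem_ofFn]
    rfl
  rw [hlist, List.sum_ofFn]
  rfl

/-- The offset of table `s`, in unary (capped). [folklore] -/
noncomputable def offU (ar : List ℕ) (s : Fin ar.length) : List Bool → List Bool := tbU (ar.take s)

/-- `offU ar s z = 1^{tableOffset ar n s}` when `n ≤ |z|`. [folklore] -/
theorem offU_of_le (ar : List ℕ) (s : Fin ar.length) {z : List Bool} (h : nOf z ≤ z.length) :
    offU ar s z = ones (tableOffset ar (nOf z) s) := by
  rw [offU, tbU_eq, Nat.min_eq_left h, tableOffset_eq_sum_take]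

/-- `offU ar s ∈ FP`. [folklore] -/
theorem offU_mem_FP (ar : List ℕ) (s : Fin ar.length) : offU ar s ∈ FP := tbU_mem_FP _

end Unary

/-! ### Assignments of the free variables -/

section Assign

/-- The code of an assignment (a list of values): nested pairs of canonical numerals.
[folklore] -/
def codeL : List ℕ → List Bool
  | [] => []
  | x :: r => boolPair (encodeNat x) (codeL r)

/-- The instance part of an argument word `⟨z, assignment⟩` (`fstP`). [folklore] -/
def zFn : List Bool → List Bool := fstP
/-- The assignment part of an argument word (`sndP`). [folklore] -/
def asFn : List Bool → List Bool := sndP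

/-- `zFn ∈ FP`. [folklore] -/
theorem zFn_mem_FP : zFn ∈ FP := fstP_mem_FP
/-- `asFn ∈ FP`. [folklore] -/
theorem asFn_mem_FP : asFn ∈ FP := sndP_mem_FP

/-- Iterated second projections on an assignment code drop values. [folklore] -/
theorem iterate_sndP_codeL (i : ℕ) : ∀ vs : List ℕ, sndP^[i] (codeL vs) = codeL (vs.drop i) := by
  induction i with
  | zero => intro vs; rfl
  | succ i ih =>
    intro vs
    cases vs with
    | nil =>
      rw [Function.iterate_succ_apply]
      simp only [codeL, sndP, boolUnpair, List.drop_nil]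
      clear ih
      induction i with
      | zero => rfl
      | succ i ih => rw [Function.iterate_succ_apply]; simpa [sndP, boolUnpair] using ih
    | cons x r => rw [Function.iterate_succ_apply]; simp [codeL, ih]

/-- A fixed number of second projections is in `FP`. [folklore] -/
theorem iterate_sndP_mem_FP (i : ℕ) : sndP^[i] ∈ FP := by
  induction i with
  | zero => exact PolyTimeComputable.id (id : List Bool → List Bool)
  | succ i ih => rw [Function.iterate_succ']; exact comp_mem_FP sndP_mem_FP ih

/-- The numeral of the value of variable `i`. [folklore] -/
noncomputable def varValFn (i : ℕ) : List Bool → List Bool := fstP ∘ sndP^[i] ∘ asFn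

/-- `varValFn i ⟨z, codeL vs⟩ = bin vs[i]`. [folklore] -/
theorem varValFn_arg (z : List Bool) (vs : List ℕ) {i : ℕ} (hi : i < vs.length) :
    varValFn i (boolPair z (codeL vs)) = encodeNat vs[i] := by
  simp only [varValFn, Function.comp_apply, asFn, sndP_boolPair, iterate_sndP_codeL]
  rw [List.drop_eq_getElem_cons hi]
  simp [codeL]

/-- `varValFn i ∈ FP`. [folklore] -/
theorem varValFn_mem_FP (i : ℕ) : varValFn i ∈ FP :=
  comp_mem_FP fstP_mem_FP (comp_mem_FP (iterate_sndP_mem_FP i) asFn_mem_FP)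

/-- The value of variable `i` in unary, capped by the instance length. [folklore] -/
noncomputable def varU (i : ℕ) : List Bool → List Bool := binToUnaryFn ∘ fanoutFn zFn (varValFn i)

/-- `varU i ⟨z, codeL vs⟩ = 1^{vs[i]}` when `vs[i] ≤ |z|`. [folklore] -/
theorem varU_arg (z : List Bool) (vs : List ℕ) {i : ℕ} (hi : i < vs.length) (hle : vs[i] ≤ z.length) :
    varU i (boolPair z (codeL vs)) = ones vs[i] := by
  simp only [varU, Function.comp_apply, fanoutFn_apply, zFn, fstP_boolPair, varValFn_arg z vs hi,
    binToUnaryFn_boolPair, bitsToNat_encodeNat, Nat.min_eq_left hle]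

/-- `varU i ∈ FP`. [folklore] -/
theorem varU_mem_FP (i : ℕ) : varU i ∈ FP :=
  comp_mem_FP binToUnaryFn_mem_FP (fanoutFn_mem_FP zFn_mem_FP (varValFn_mem_FP i))

/-- EXTENDING an assignment: `snocFn l ⟨codeL vs, bin a⟩ = codeL (vs ++ [a])` for `|vs| = l`
(rebuild the nested pairs, the new numeral innermost). [folklore] -/
noncomputable def snocFn : ℕ → (List Bool → List Bool)
  | 0 => fanoutFn sndP (fun _ => [])
  | l + 1 => fanoutFn (fstP ∘ fstP) (snocFn l ∘ fanoutFn (sndP ∘ fstP) sndP)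

/-- The code of `vs` with a raw numeral `c` appended innermost. [folklore] -/
def codeLsnoc : List ℕ → List Bool → List Bool
  | [], c => boolPair c []
  | x :: r, c => boolPair (encodeNat x) (codeLsnoc r c)

/-- `codeLsnoc vs (bin a) = codeL (vs ++ [a])`. [folklore] -/
theorem codeLsnoc_encodeNat (vs : List ℕ) (a : ℕ) : codeLsnoc vs (encodeNat a) = codeL (vs ++ [a]) := by
  induction vs with
  | nil => rfl
  | cons x r ih => simp [codeLsnoc, codeL, ih]

/-- Specification of `snocFn` on a pair `⟨codeL vs, c⟩` with `|vs| = l`. [folklore] -/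
theorem snocFn_spec (l : ℕ) : ∀ (vs : List ℕ), vs.length = l → ∀ c : List Bool,
    snocFn l (boolPair (codeL vs) c) = codeLsnoc vs c := by
  induction l with
  | zero =>
    intro vs h c
    cases vs with
    | nil => rw [snocFn]; simp [codeL, codeLsnoc, fanoutFn_apply]
    | cons x r => simp at h
  | succ l ih =>
    intro vs h c
    cases vs with
    | nil => simp at h
    | cons x r =>
      simp only [List.length_cons, Nat.add_right_cancel_iff] at h
      rw [snocFn]
      simp only [fanoutFn_apply, Function.comp_apply, codeL, fstP_boolPair, sndP_boolPair, codeLsnoc]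
      rw [ih r h c]

/-- `snocFn l ∈ FP`. [folklore] -/
theorem snocFn_mem_FP (l : ℕ) : snocFn l ∈ FP := by
  induction l with
  | zero => rw [snocFn]; exact fanoutFn_mem_FP sndP_mem_FP (const_mem_FP _)
  | succ l ih =>
    rw [snocFn]
    exact fanoutFn_mem_FP (comp_mem_FP fstP_mem_FP fstP_mem_FP)
      (comp_mem_FP ih (fanoutFn_mem_FP (comp_mem_FP sndP_mem_FP fstP_mem_FP) sndP_mem_FP))

end Assign

/-! ### Horner evaluation of a table position, and the table lookup of an atom -/

section Horner

/-- One round of the unary adder: keep the amount, apply `succFn` to the header. [folklore] -/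
noncomputable def succRound : List Bool → List Bool := fanoutFn fstP (succFn ∘ sndP)

/-- `succRound ⟨q, w⟩ = ⟨q, succFn w⟩`. [folklore] -/
@[simp] theorem succRound_boolPair (q w : List Bool) : succRound (boolPair q w) = boolPair q (succFn w) := by
  simp [succRound, fanoutFn_apply]

/-- `succFn` lengthens by at most two. [folklore] -/
theorem length_succFn_le (u : List Bool) : (succFn u).length ≤ u.length + 2 := by
  have := splitOnes_le u
  simp [succFn, ones]; omega

/-- Additive growth of `succRound`. [folklore] -/
theorem length_succRound_le (w : List Bool) : (succRound w).length ≤ w.length + 4 := by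
  unfold succRound
  rw [fanoutFn_apply, length_boolPair]
  have h := OracleCompose.length_boolUnpair_le w
  have h2 := length_succFn_le (boolUnpair w).2
  simp only [Function.comp_apply, fstP, sndP] at *
  omega

/-- `succRound ∈ FP`. [folklore] -/
theorem succRound_mem_FP : succRound ∈ FP :=
  fanoutFn_mem_FP fstP_mem_FP (comp_mem_FP succFn_mem_FP sndP_mem_FP)

/-- THE UNARY ADDER on headers: `iterSuccFn ⟨q, w⟩ = succFn^[|q|] w`. [folklore] -/
noncomputable def iterSuccFn : List Bool → List Bool :=
  sndP ∘ fun w => succRound^[(Polynomial.X : Polynomial ℕ).eval (boolUnpair w).1.length] w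

/-- `iterSuccFn (boolPair q w) = succFn^[|q|] w`. [folklore] -/
@[simp] theorem iterSuccFn_boolPair (q w : List Bool) : iterSuccFn (boolPair q w) = succFn^[q.length] w := by
  have : ∀ k, succRound^[k] (boolPair q w) = boolPair q (succFn^[k] w) := fun k => by
    induction k generalizing w with
    | zero => rfl
    | succ k ih => rw [Function.iterate_succ_apply, succRound_boolPair, ih, ← Function.iterate_succ_apply]
  simp [iterSuccFn, this, sndP]

/-- `iterSuccFn ∈ FP`. [folklore] -/
theorem iterSuccFn_mem_FP : iterSuccFn ∈ FP :=
  comp_mem_FP sndP_mem_FP (iterate_mem_FP succRound_mem_FP 4 length_succRound_le Polynomial.X)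

/-- The header of the instance part. [folklore] -/
noncomputable def hdrNv : List Bool → List Bool := hdrN ∘ zFn

/-- HORNER EVALUATION of the position `Σⱼ x_{argsⱼ} nʲ` in the accumulator of a header: for the
argument list `[i₀, …, i_{a-1}]`, `x_{i₀} + n · (x_{i₁} + n · (…))`. [Libkin 2004, §6.1 (the
`j`th tuple in the lexicographic enumeration)] [folklore] -/
noncomputable def hornerFn : List ℕ → (List Bool → List Bool)
  | [] => hdrNv
  | i :: rest => iterSuccFn ∘ fanoutFn (varU i) (mulFn ∘ hornerFn rest)

/-- The value computed by Horner's rule. [folklore] -/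
def hval (n : ℕ) (vs : List ℕ) : List ℕ → ℕ
  | [] => 0
  | i :: rest => vs.getD i 0 + n * hval n vs rest

/-- **Specification of the Horner evaluator** on an argument word whose instance part has
`n ≤ |z|` and whose values are `< n`. [folklore] -/
theorem hornerFn_spec (z : List Bool) (hz : nOf z ≤ z.length) (vs : List ℕ) (hvs : ∀ x ∈ vs, x < nOf z)
    (args : List ℕ) (hargs : ∀ i ∈ args, i < vs.length) :
    hornerFn args (boolPair z (codeL vs)) = hdr (nOf z) (hval (nOf z) vs args) (boolPair (onesN z) []) := by
  induction args with
  | nil =>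
    rw [hornerFn]
    simp only [hdrNv, Function.comp_apply, zFn, fstP_boolPair, hdrN_eq, Nat.min_eq_left hz, hval]
  | cons i rest ih =>
    have hi : i < vs.length := hargs i (by simp)
    have hrest : ∀ j ∈ rest, j < vs.length := fun j hj => hargs j (by simp [hj])
    have hle : vs[i] ≤ z.length := ((hvs _ (List.getElem_mem hi)).le).trans hz
    rw [hornerFn]
    simp only [Function.comp_apply, fanoutFn_apply, ih hrest, mulFn_hdr, varU_arg z vs hi hle,
      iterSuccFn_boolPair, iterate_succFn_hdr, hval, List.getD_eq_getElem _ _ hi]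
    simp only [ones, List.length_replicate]
    ring_nf

/-- `hornerFn args ∈ FP`. [folklore] -/
theorem hornerFn_mem_FP (args : List ℕ) : hornerFn args ∈ FP := by
  induction args with
  | nil => rw [hornerFn]; exact comp_mem_FP hdrN_mem_FP zFn_mem_FP
  | cons i rest ih =>
    rw [hornerFn]
    exact comp_mem_FP iterSuccFn_mem_FP (fanoutFn_mem_FP (varU_mem_FP i) (comp_mem_FP mulFn_mem_FP ih))

/-- The Horner value of an `ofFn` argument list is the little-endian number of the digits.
[folklore] -/
theorem hval_ofFn (n : ℕ) (vs : List ℕ) : ∀ {a : ℕ} (args : Fin a → ℕ),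
    hval n vs (List.ofFn args) = ∑ j : Fin a, vs.getD (args j) 0 * n ^ (j : ℕ)
  | 0, args => by simp [hval]
  | a + 1, args => by
    rw [List.ofFn_succ, hval, hval_ofFn n vs (fun j => args j.succ), Fin.sum_univ_succ, Finset.mul_sum]
    simp only [Fin.val_zero, pow_zero, mul_one, Fin.val_succ, pow_succ]
    congr 1
    exact Finset.sum_congr rfl fun j _ => by ring

/-- THE POSITION OF AN ATOM in unary: offset of table `s`, then the Horner value. [folklore] -/
noncomputable def atomIdxFn (ar : List ℕ) (s : Fin ar.length) (args : List ℕ) (v : List Bool) : List Bool :=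
  offU ar s (zFn v) ++ OracleCompose.midT.eval (hornerFn args v)

/-- `atomIdxFn ar s args ∈ FP`. [folklore] -/
theorem atomIdxFn_mem_FP (ar : List ℕ) (s : Fin ar.length) (args : List ℕ) : atomIdxFn ar s args ∈ FP :=
  append_mem_FP (comp_mem_FP (offU_mem_FP ar s) zFn_mem_FP)
    (comp_mem_FP OracleCompose.midT.polyTimeComputable_eval (hornerFn_mem_FP args))

/-- Length of the position of an atom. [folklore] -/
theorem length_atomIdxFn (ar : List ℕ) (s : Fin ar.length) (z : List Bool) (hz : nOf z ≤ z.length)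
    (vs : List ℕ) (hvs : ∀ x ∈ vs, x < nOf z) (args : List ℕ) (hargs : ∀ i ∈ args, i < vs.length) :
    (atomIdxFn ar s args (boolPair z (codeL vs))).length = tableOffset ar (nOf z) s + hval (nOf z) vs args := by
  unfold atomIdxFn
  rw [List.length_append, show zFn (boolPair z (codeL vs)) = z by simp [zFn], offU_of_le ar s hz,
    hornerFn_spec z hz vs hvs args hargs, OracleCompose.midT_eval_hdr]
  simp

/-- The table LOOKUP: the bit of a table segment at the position of the atom. [folklore] -/
noncomputable def lookupFn (seg : List Bool → List Bool) (ar : List ℕ) (s : Fin ar.length)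
    (args : List ℕ) : List Bool → List Bool :=
  bitAtFn ∘ fanoutFn (atomIdxFn ar s args) (seg ∘ zFn)

/-- `lookupFn seg ar s args ∈ FP` for `seg ∈ FP`. [folklore] -/
theorem lookupFn_mem_FP {seg : List Bool → List Bool} (hseg : seg ∈ FP) (ar : List ℕ) (s : Fin ar.length)
    (args : List ℕ) : lookupFn seg ar s args ∈ FP :=
  comp_mem_FP bitAtFn_mem_FP (fanoutFn_mem_FP (atomIdxFn_mem_FP ar s args) (comp_mem_FP hseg zFn_mem_FP))

/-- **The lookup reads the right table bit**: if the segment of `z` is the table bits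
`List.ofFn (relTablesEquiv ar n T)` of tables `T`, then for digits `w j = vs[args j] < n` the
lookup returns `[T s w]`. [Libkin 2004, (6.1)] [folklore] -/
theorem lookupFn_spec {ar : List ℕ} {n : ℕ} (T : RelTables ar n) (seg : List Bool → List Bool)
    (z : List Bool) (hn : nOf z = n) (hz : nOf z ≤ z.length) (hseg : seg z = List.ofFn (relTablesEquiv ar n T))
    (vs : List ℕ) (hvs : ∀ x ∈ vs, x < n) (s : Fin ar.length) (args : Fin (ar.get s) → ℕ)
    (hargs : ∀ j, args j < vs.length) :
    lookupFn seg ar s (List.ofFn args) (boolPair z (codeL vs)) =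
      [T s fun j => ⟨vs[args j]'(hargs j), hvs _ (List.getElem_mem _)⟩] := by
  subst hn
  set w : Fin (ar.get s) → Fin (nOf z) := fun j => ⟨vs[args j]'(hargs j), hvs _ (List.getElem_mem _)⟩ with hw
  have hargs' : ∀ i ∈ List.ofFn args, i < vs.length := fun i hi => by
    obtain ⟨j, rfl⟩ := List.mem_ofFn.1 hi; exact hargs j
  have hlen : (atomIdxFn ar s (List.ofFn args) (boolPair z (codeL vs))).length =
      ((finSigmaFinEquiv ⟨s, finFunctionFinEquiv w⟩ : Fin (tableBits ar (nOf z))) : ℕ) := by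
    rw [length_atomIdxFn ar s z hz vs hvs _ hargs', val_finSigmaFinEquiv_table, finFunctionFinEquiv_apply,
      hval_ofFn]
    congr 1
    exact Finset.sum_congr rfl fun j _ => by rw [List.getD_eq_getElem _ _ (hargs j)]
  unfold lookupFn
  simp only [Function.comp_apply, fanoutFn_apply, zFn, fstP_boolPair, hseg]
  rw [bitAtFn_boolPair_of_lt _ _ (by rw [hlen, List.length_ofFn]; exact Fin.is_lt _)]
  simp only [List.getElem_ofFn]
  rw [show (⟨(atomIdxFn ar s (List.ofFn args) (boolPair z (codeL vs))).length, _⟩ : Fin (tableBits ar (nOf z))) =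
    finSigmaFinEquiv ⟨s, finFunctionFinEquiv w⟩ from Fin.ext hlen, relTablesEquiv_apply_table]

end Horner

/-! ### The evaluator -/

section Eval

variable {ar wit : List ℕ}

/-- The variable index of a term of the joint (relational) vocabulary with bound variables only.
[folklore] -/
def termVar {l : ℕ} : ((relLanguage ar).sum (relLanguage wit)).Term (Empty ⊕ Fin l) → ℕ
  | FirstOrder.Language.Term.var (Sum.inl e) => e.elim
  | FirstOrder.Language.Term.var (Sum.inr i) => i
  | FirstOrder.Language.Term.func f _ => isEmptyElim f

/-- Every term is a bound variable. [folklore] -/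
theorem term_eq_var {l : ℕ} (t : ((relLanguage ar).sum (relLanguage wit)).Term (Empty ⊕ Fin l)) :
    ∃ i : Fin l, t = FirstOrder.Language.Term.var (Sum.inr i) ∧ termVar t = i := by
  rcases t with (e | i) | ⟨f, _⟩
  · exact e.elim
  · exact ⟨i, rfl, rfl⟩
  · exact isEmptyElim f

/-! #### The loop of a universal quantifier -/

/-- The argument word for the next value: `⟨z, snocFn l ⟨as, c⟩⟩` from the loop state
`⟨z, ⟨as, ⟨c, acc⟩⟩⟩` (fields `cvR`, `cvU`, `cvC`, `cvA` of `FPStringBricks.lean`). [folklore] -/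
noncomputable def mkArg (l : ℕ) : List Bool → List Bool :=
  fanoutFn cvR (snocFn l ∘ fanoutFn cvU cvC)

/-- The update of the loop: increment the counter; the accumulator becomes the evaluation at the
current value if it was `1`, and `0` otherwise (cut to one symbol). [folklore] -/
noncomputable def allUpd (l : ℕ) (E : List Bool → List Bool) : List Bool → List Bool :=
  fanoutFn cvR (fanoutFn cvU (fanoutFn (addFn ∘ fanoutFn cvC (fun _ => encodeNat 1))
    (take1Fn ∘ iteFn cvA (E ∘ mkArg l) (fun _ => [false]))))

/-- One round of the loop: update while the counter is below the universe size. [folklore] -/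
noncomputable def allRound (l : ℕ) (E : List Bool → List Bool) : List Bool → List Bool :=
  iteFn (ltFn ∘ fanoutFn cvC (uOf ∘ cvR)) (allUpd l E) id

/-- The initial loop state `⟨z, ⟨as, ⟨bin 0, [1]⟩⟩⟩` of an argument word `⟨z, as⟩`. [folklore] -/
noncomputable def allInit : List Bool → List Bool :=
  fanoutFn zFn (fanoutFn asFn (fun _ => boolPair [] [true]))

/-- THE LOOP OF A UNIVERSAL QUANTIFIER: `|z|` rounds, then the accumulator. [Libkin 2004,
Prop. 6.6 (proof: enumerate the values of the quantified variable)] [folklore] -/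
noncomputable def allFn (l : ℕ) (E : List Bool → List Bool) : List Bool → List Bool :=
  cvA ∘ (fun w => (allRound l E)^[(Polynomial.X : Polynomial ℕ).eval (boolUnpair w).1.length] w) ∘ allInit

/-- `mkArg l ∈ FP`. [folklore] -/
theorem mkArg_mem_FP (l : ℕ) : mkArg l ∈ FP :=
  fanoutFn_mem_FP cvR_mem_FP (comp_mem_FP (snocFn_mem_FP l) (fanoutFn_mem_FP cvU_mem_FP cvC_mem_FP))

/-- `allUpd l E ∈ FP` for `E ∈ FP`. [folklore] -/
theorem allUpd_mem_FP (l : ℕ) {E : List Bool → List Bool} (hE : E ∈ FP) : allUpd l E ∈ FP :=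
  fanoutFn_mem_FP cvR_mem_FP (fanoutFn_mem_FP cvU_mem_FP (fanoutFn_mem_FP
    (comp_mem_FP addFn_mem_FP (fanoutFn_mem_FP cvC_mem_FP (const_mem_FP _)))
    (comp_mem_FP take1Fn_mem_FP (iteFn_mem_FP cvA_mem_FP (comp_mem_FP hE (mkArg_mem_FP l)) (const_mem_FP _)))))

/-- `allRound l E ∈ FP` for `E ∈ FP`. [folklore] -/
theorem allRound_mem_FP (l : ℕ) {E : List Bool → List Bool} (hE : E ∈ FP) : allRound l E ∈ FP :=
  iteFn_mem_FP (comp_mem_FP ltFn_mem_FP (fanoutFn_mem_FP cvC_mem_FP (comp_mem_FP uOf_mem_FP cvR_mem_FP)))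
    (allUpd_mem_FP l hE) OracleCompose.id_mem_FP

/-- **Additive growth of a round, on every word** (the counter gains at most one bit, the
accumulator is one symbol). [folklore] -/
theorem length_allRound_le (l : ℕ) (E : List Bool → List Bool) (w : List Bool) :
    (allRound l E w).length ≤ w.length + 12 := by
  have hc : (ltFn ∘ fanoutFn cvC (uOf ∘ cvR)) w = [decide (bitsToNat (cvC w) < bitsToNat (uOf (cvR w)))] := by
    simp [fanoutFn_apply]
  unfold allRound
  rw [iteFn_apply hc]
  split_ifs
  · simp only [allUpd, fanoutFn_apply, Function.comp_apply, length_boolPair, addFn_boolPair, bitsToNat_encodeNat]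
    have h0 := OracleCompose.length_boolUnpair_le w
    have h1 := OracleCompose.length_boolUnpair_le (boolUnpair w).2
    have h2 := OracleCompose.length_boolUnpair_le (boolUnpair (boolUnpair w).2).2
    have h3 : (encodeNat (bitsToNat (cvC w) + 1)).length ≤ (cvC w).length + 1 :=
      (length_encodeNat_succ_le _).trans (Nat.succ_le_succ (Brick.length_encodeNat_bitsToNat_le _))
    have h4 : (take1Fn (iteFn cvA (E ∘ mkArg l) (fun _ => [false]) w)).length ≤ 1 := by
      simp [take1Fn]
    simp only [cvR, cvU, cvC, fstP, sndP, Function.comp_apply] at *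
    omega
  · simp

/-- `allFn l E ∈ FP` for `E ∈ FP`. [folklore] -/
theorem allFn_mem_FP (l : ℕ) {E : List Bool → List Bool} (hE : E ∈ FP) : allFn l E ∈ FP :=
  comp_mem_FP cvA_mem_FP (comp_mem_FP (iterate_mem_FP (allRound_mem_FP l hE) 12 (length_allRound_le l E)
    Polynomial.X) (fanoutFn_mem_FP zFn_mem_FP (fanoutFn_mem_FP asFn_mem_FP (const_mem_FP _))))

/-- One round on a loop state with counter `bin m` and a one-bit accumulator. [folklore] -/
theorem allRound_state (l : ℕ) (E : List Bool → List Bool) (z as : List Bool) (m : ℕ) (b : Bool) :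
    allRound l E (boolPair z (boolPair as (boolPair (encodeNat m) [b]))) =
      if m < nOf z then boolPair z (boolPair as (boolPair (encodeNat (m + 1))
        (take1Fn (if b then E (boolPair z (snocFn l (boolPair as (encodeNat m)))) else [false]))))
      else boolPair z (boolPair as (boolPair (encodeNat m) [b])) := by
  have hc : (ltFn ∘ fanoutFn cvC (uOf ∘ cvR)) (boolPair z (boolPair as (boolPair (encodeNat m) [b]))) =
      [decide (m < nOf z)] := by
    simp [fanoutFn_apply, cvC, cvR, fstP, sndP, nOf, uOf]
  unfold allRound
  rw [iteFn_apply hc]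
  by_cases h : m < nOf z
  · rw [decide_eq_true h, if_pos rfl, if_pos h]
    have hacc : iteFn cvA (E ∘ mkArg l) (fun _ => [false]) (boolPair z (boolPair as (boolPair (encodeNat m) [b]))) =
        if b then E (boolPair z (snocFn l (boolPair as (encodeNat m)))) else [false] := by
      rw [iteFn_apply (show cvA (boolPair z (boolPair as (boolPair (encodeNat m) [b]))) = [b] by simp [cvA, sndP])]
      simp [mkArg, fanoutFn_apply, cvR, cvU, cvC, fstP, sndP]
    simp [allUpd, fanoutFn_apply, cvR, cvU, cvC, fstP, sndP, bitsToNat_encodeNat, hacc]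
  · rw [decide_eq_false h, if_neg h]
    simp

/-- The loop invariant: from counter `bin m` (`m ≤ n`) with accumulator `[∀ a < m, P a]`, `k`
rounds reach counter `bin (min (m+k) n)` with accumulator `[∀ a < min (m+k) n, P a]`, provided
the evaluation at each value `a < n` is the bit `[P a]`. [folklore] -/
theorem iterate_allRound (l : ℕ) (E : List Bool → List Bool) (z as : List Bool) (P : ℕ → Prop)
    [DecidablePred P] (hE : ∀ a : ℕ, a < nOf z → E (boolPair z (snocFn l (boolPair as (encodeNat a)))) = [decide (P a)])
    (k m : ℕ) (hm : m ≤ nOf z) :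
    (allRound l E)^[k] (boolPair z (boolPair as (boolPair (encodeNat m) [decide (∀ a : ℕ, a < m → P a)]))) =
      boolPair z (boolPair as (boolPair (encodeNat (min (m + k) (nOf z)))
        [decide (∀ a : ℕ, a < min (m + k) (nOf z) → P a)])) := by
  induction k generalizing m with
  | zero => simp [Nat.min_eq_left hm]
  | succ k ih =>
    rw [Function.iterate_succ_apply, allRound_state]
    by_cases h : m < nOf z
    · rw [if_pos h]
      have hstep : take1Fn (if decide (∀ a : ℕ, a < m → P a) then E (boolPair z (snocFn l (boolPair as (encodeNat m))))
          else [false]) = [decide (∀ a : ℕ, a < m + 1 → P a)] := by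
        by_cases hall : ∀ a, a < m → P a
        · rw [decide_eq_true hall, if_pos rfl, hE m h]
          simp only [take1Fn, List.take_succ_cons, List.take_zero]
          congr 1
          apply Bool.decide_congr
          constructor
          · intro hP a ha
            rcases Nat.lt_succ_iff_lt_or_eq.1 ha with ha | rfl
            · exact hall a ha
            · exact hP
          · intro H; exact H m (Nat.lt_succ_self m)
        · rw [decide_eq_false hall]
          simp only [take1Fn, Bool.false_eq_true, ↓reduceIte, List.take_succ_cons, List.take_zero]
          congr 1; symm
          rw [decide_eq_false_iff_not]
          exact fun H => hall fun a ha => H a (Nat.lt_succ_of_lt ha)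
      rw [hstep, ih (m + 1) h, show m + 1 + k = m + (k + 1) by ring]
    · have hm' : m = nOf z := le_antisymm hm (not_lt.1 h)
      rw [if_neg h, ih m hm]
      subst hm'
      simp

/-- **Specification of the loop**: on `⟨z, as⟩` (rounds `|z| ≥ n`), the accumulator is the
bit `[∀ a < n, P a]`. [Libkin 2004, Prop. 6.6 (proof)] [folklore] -/
theorem allFn_spec (l : ℕ) (E : List Bool → List Bool) (z as : List Bool) (hz : nOf z ≤ z.length)
    (P : ℕ → Prop) [DecidablePred P]
    (hE : ∀ a : ℕ, a < nOf z → E (boolPair z (snocFn l (boolPair as (encodeNat a)))) = [decide (P a)]) :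
    allFn l E (boolPair z as) = [decide (∀ a : ℕ, a < nOf z → P a)] := by
  have hdec : (true : Bool) = decide (∀ a : ℕ, a < 0 → P a) := by simp
  have h0 : allInit (boolPair z as) = boolPair z (boolPair as (boolPair (encodeNat 0) [decide (∀ a : ℕ, a < 0 → P a)])) := by
    rw [← hdec]; simp [allInit, fanoutFn_apply, zFn, asFn]; rfl
  simp only [allFn, Function.comp_apply, h0, boolUnpair_boolPair, Polynomial.eval_X]
  rw [iterate_allRound l E z as P hE _ 0 (Nat.zero_le _), Nat.zero_add, Nat.min_eq_right hz]
  simp [cvA, sndP]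

/-! #### The recursion on formulas -/

/-- The argument list of an input atom: the variable indices of its terms. [folklore] -/
def inArgs {l k : ℕ} (r : (relLanguage ar).Relations k) (ts : Fin k → ((relLanguage ar).sum (relLanguage wit)).Term (Empty ⊕ Fin l)) :
    List ℕ :=
  List.ofFn fun j : Fin (ar.get r.1) => termVar (ts (Fin.cast r.2 j))

/-- The argument list of a witness atom. [folklore] -/
def witArgs {l k : ℕ} (r : (relLanguage wit).Relations k) (ts : Fin k → ((relLanguage ar).sum (relLanguage wit)).Term (Empty ⊕ Fin l)) :
    List ℕ :=
  List.ofFn fun j : Fin (wit.get r.1) => termVar (ts (Fin.cast r.2 j))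

/-- **THE EVALUATOR** of a first-order formula of the joint vocabulary, as a total string
function on argument words `⟨z, assignment⟩` (brute force: Libkin 2004, Prop. 6.6). [Libkin 2004,
Prop. 6.6 (proof)] [folklore] -/
noncomputable def evalFn : ∀ {l : ℕ}, ((relLanguage ar).sum (relLanguage wit)).BoundedFormula Empty l → (List Bool → List Bool)
  | _, FirstOrder.Language.BoundedFormula.falsum => fun _ => [false]
  | _, FirstOrder.Language.BoundedFormula.equal t₁ t₂ =>
      eqPairFn ∘ fanoutFn (varValFn (termVar t₁)) (varValFn (termVar t₂))
  | _, FirstOrder.Language.BoundedFormula.rel (Sum.inl r) ts => lookupFn tOf ar r.1 (inArgs r ts)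
  | _, FirstOrder.Language.BoundedFormula.rel (Sum.inr r) ts => lookupFn yOf wit r.1 (witArgs r ts)
  | _, FirstOrder.Language.BoundedFormula.imp f₁ f₂ => iteFn (evalFn f₁) (evalFn f₂) (fun _ => [true])
  | l, FirstOrder.Language.BoundedFormula.all f => allFn l (evalFn f)

/-- **The evaluator is polynomial time.** [Libkin 2004, Prop. 6.6] [folklore] -/
theorem evalFn_mem_FP : ∀ {l : ℕ} (φ : ((relLanguage ar).sum (relLanguage wit)).BoundedFormula Empty l), evalFn φ ∈ FP
  | _, FirstOrder.Language.BoundedFormula.falsum => by rw [evalFn]; exact const_mem_FP _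
  | _, FirstOrder.Language.BoundedFormula.equal t₁ t₂ => by
    rw [evalFn]; exact comp_mem_FP eqPairFn_mem_FP (fanoutFn_mem_FP (varValFn_mem_FP _) (varValFn_mem_FP _))
  | _, FirstOrder.Language.BoundedFormula.rel (Sum.inl r) ts => by rw [evalFn]; exact lookupFn_mem_FP tOf_mem_FP _ _ _
  | _, FirstOrder.Language.BoundedFormula.rel (Sum.inr r) ts => by rw [evalFn]; exact lookupFn_mem_FP yOf_mem_FP _ _ _
  | _, FirstOrder.Language.BoundedFormula.imp f₁ f₂ => by
    rw [evalFn]; exact iteFn_mem_FP (evalFn_mem_FP f₁) (evalFn_mem_FP f₂) (const_mem_FP _)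
  | _, FirstOrder.Language.BoundedFormula.all f => by rw [evalFn]; exact allFn_mem_FP _ (evalFn_mem_FP f)

end Eval

/-! ### Correctness of the evaluator -/

section Spec

open scoped Classical

variable {ar wit : List ℕ} {n : ℕ} (R : RelTables ar n) (W : RelTables wit n)

/-- Satisfaction of a bounded formula in the joint structure `(Fin n, R, W)` (Mathlib
`BoundedFormula.Realize` with the structure explicit). [folklore] -/
def RealizesB {l : ℕ} (φ : ((relLanguage ar).sum (relLanguage wit)).BoundedFormula Empty l)
    (xs : Fin l → Fin n) : Prop :=
  @FirstOrder.Language.BoundedFormula.Realize _ (Fin n)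
    (@FirstOrder.Language.sumStructure _ _ (Fin n) (structureOfTables R) (structureOfTables W)) Empty l φ
    default xs

/-- The assignment coded by a list of values below `n`. [folklore] -/
def xsOf (vs : List ℕ) {l : ℕ} (hl : vs.length = l) (hvs : ∀ x ∈ vs, x < n) : Fin l → Fin n :=
  fun i => ⟨vs[i.1]'(hl ▸ i.2), hvs _ (List.getElem_mem _)⟩

variable {R W}

/-- The value of a term (a bound variable) under an assignment. [folklore] -/
theorem realize_term_eq {l : ℕ} (t : ((relLanguage ar).sum (relLanguage wit)).Term (Empty ⊕ Fin l))
    (xs : Fin l → Fin n) (h : termVar t < l) :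
    @FirstOrder.Language.Term.realize _ (Fin n)
      (@FirstOrder.Language.sumStructure _ _ (Fin n) (structureOfTables R) (structureOfTables W)) _
      (Sum.elim default xs) t = xs ⟨termVar t, h⟩ := by
  obtain ⟨i, rfl, hi⟩ := term_eq_var t
  rfl

/-- `termVar t < l`. [folklore] -/
theorem termVar_lt {l : ℕ} (t : ((relLanguage ar).sum (relLanguage wit)).Term (Empty ⊕ Fin l)) : termVar t < l := by
  obtain ⟨i, rfl, hi⟩ := term_eq_var t; rw [hi]; exact i.2

/-- Extending a coded assignment is `Fin.snoc`. [folklore] -/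
theorem xsOf_append (vs : List ℕ) {l : ℕ} (hl : vs.length = l) (hvs : ∀ x ∈ vs, x < n) (a : ℕ) (ha : a < n) :
    xsOf (vs ++ [a]) (by simp [hl]) (fun x hx => by
      rcases List.mem_append.1 hx with hx | hx
      · exact hvs x hx
      · rw [List.mem_singleton.1 hx]; exact ha) = Fin.snoc (xsOf vs hl hvs) ⟨a, ha⟩ := by
  funext i
  refine Fin.lastCases ?_ (fun j => ?_) i
  · apply Fin.ext
    simp [xsOf, Fin.snoc_last, ← hl]
  · apply Fin.ext
    simp only [xsOf, Fin.snoc_castSucc, Fin.val_castSucc]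
    exact List.getElem_append_left (by rw [hl]; exact j.2)

/-- **Correctness of the evaluator**: on an argument word `⟨z, codeL vs⟩` with `z` the genuine
pair of `(R, W)` and `n ≤ |z|`, the evaluator returns the truth bit of the formula under the
coded assignment. [Libkin 2004, Prop. 6.6] [folklore] -/
theorem evalFn_spec (z : List Bool) (hzRW : z = boolPair (codeOf R) ((encodingRelTables wit n).encode W))
    (hz : n ≤ z.length) : ∀ {l : ℕ} (φ : ((relLanguage ar).sum (relLanguage wit)).BoundedFormula Empty l)
      (vs : List ℕ) (hl : vs.length = l) (hvs : ∀ x ∈ vs, x < n),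
      evalFn φ (boolPair z (codeL vs)) = [decide (RealizesB R W φ (xsOf vs hl hvs))] := by
  have hdec := decode_boolPair n R W
  rw [← hzRW] at hdec
  obtain ⟨hxz, hyz, huz, htz, hnz⟩ := hdec
  have hz' : nOf z ≤ z.length := by rw [hnz]; exact hz
  letI := @FirstOrder.Language.sumStructure _ _ (Fin n) (structureOfTables R) (structureOfTables W)
  intro l φ
  induction φ with
  | falsum =>
    intro vs hl hvs
    rw [evalFn]
    simp [RealizesB, FirstOrder.Language.BoundedFormula.Realize]
  | equal t₁ t₂ =>
    intro vs hl hvs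
    rw [evalFn]
    have h1 := termVar_lt t₁; have h2 := termVar_lt t₂
    simp only [Function.comp_apply, fanoutFn_apply, varValFn_arg z vs (show termVar t₁ < vs.length by omega),
      varValFn_arg z vs (show termVar t₂ < vs.length by omega), eqPairFn_boolPair]
    congr 1
    rw [decide_eq_decide]
    unfold RealizesB
    simp only [FirstOrder.Language.BoundedFormula.Realize, realize_term_eq t₁ _ h1, realize_term_eq t₂ _ h2,
      xsOf, Fin.mk.injEq]
    constructor
    · intro h; have := congrArg decodeNat h; rwa [decode_encodeNat, decode_encodeNat] at this
    · intro h; rw [h]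
  | rel Rs ts =>
    intro vs hl hvs
    rcases Rs with ⟨s, hs⟩ | ⟨s, hs⟩
    · rw [evalFn]
      have hargs : ∀ j : Fin (ar.get s), termVar (ts (Fin.cast hs j)) < vs.length := fun j => by
        rw [hl]; exact termVar_lt _
      rw [show inArgs ⟨s, hs⟩ ts = List.ofFn (fun j : Fin (ar.get s) => termVar (ts (Fin.cast hs j))) from rfl,
        lookupFn_spec R tOf z hnz hz' htz vs hvs s _ hargs]
      congr 1
      unfold RealizesB
      symm
      rw [← Bool.decide_eq_true (b := R s fun j => ⟨vs[termVar (ts (Fin.cast hs j))]'(hargs j), hvs _ (List.getElem_mem _)⟩)]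
      refine decide_eq_decide.2 ?_
      show (R s ((fun i => FirstOrder.Language.Term.realize (Sum.elim default (xsOf vs hl hvs)) (ts i)) ∘
        Fin.cast hs) = true) ↔ _
      rw [show ((fun i => FirstOrder.Language.Term.realize (Sum.elim default (xsOf vs hl hvs)) (ts i)) ∘ Fin.cast hs) =
        (fun j => ⟨vs[termVar (ts (Fin.cast hs j))]'(hargs j), hvs _ (List.getElem_mem _)⟩) from funext fun j => by
          simp only [Function.comp_apply]; rw [realize_term_eq (ts (Fin.cast hs j)) _ (termVar_lt _)]; rfl]
    · rw [evalFn]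
      have hargs : ∀ j : Fin (wit.get s), termVar (ts (Fin.cast hs j)) < vs.length := fun j => by
        rw [hl]; exact termVar_lt _
      have hyz' : yOf z = List.ofFn (relTablesEquiv wit n W) := by
        rw [hyz]; simp [encodingRelTables, encodingBitVec]
      rw [show witArgs ⟨s, hs⟩ ts = List.ofFn (fun j : Fin (wit.get s) => termVar (ts (Fin.cast hs j))) from rfl,
        lookupFn_spec W yOf z hnz hz' hyz' vs hvs s _ hargs]
      congr 1
      unfold RealizesB
      symm
      rw [← Bool.decide_eq_true (b := W s fun j => ⟨vs[termVar (ts (Fin.cast hs j))]'(hargs j), hvs _ (List.getElem_mem _)⟩)]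
      refine decide_eq_decide.2 ?_
      show (W s ((fun i => FirstOrder.Language.Term.realize (Sum.elim default (xsOf vs hl hvs)) (ts i)) ∘
        Fin.cast hs) = true) ↔ _
      rw [show ((fun i => FirstOrder.Language.Term.realize (Sum.elim default (xsOf vs hl hvs)) (ts i)) ∘ Fin.cast hs) =
        (fun j => ⟨vs[termVar (ts (Fin.cast hs j))]'(hargs j), hvs _ (List.getElem_mem _)⟩) from funext fun j => by
          simp only [Function.comp_apply]; rw [realize_term_eq (ts (Fin.cast hs j)) _ (termVar_lt _)]; rfl]
  | imp f₁ f₂ ih₁ ih₂ =>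
    intro vs hl hvs
    rw [evalFn, iteFn_apply (ih₁ vs hl hvs)]
    by_cases h1 : RealizesB R W f₁ (xsOf vs hl hvs)
    · rw [decide_eq_true h1, if_pos rfl, ih₂ vs hl hvs]
      congr 1
      rw [decide_eq_decide]
      unfold RealizesB at *
      simp only [FirstOrder.Language.BoundedFormula.Realize]
      exact ⟨fun h _ => h, fun h => h h1⟩
    · rw [decide_eq_false h1]
      simp only [Bool.false_eq_true, ↓reduceIte]
      congr 1; symm
      rw [decide_eq_true_iff]
      unfold RealizesB at *
      exact fun h => absurd h h1
  | all f ih =>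
    intro vs hl hvs
    rw [evalFn]
    rw [allFn_spec _ (evalFn f) z (codeL vs) hz' (fun a => ∃ ha : a < n, RealizesB R W f (xsOf (vs ++ [a]) (by simp [hl])
      (fun x hx => by
        rcases List.mem_append.1 hx with hx | hx
        · exact hvs x hx
        · rw [List.mem_singleton.1 hx]; exact ha)))]
    · congr 1
      rw [decide_eq_decide]
      unfold RealizesB
      simp only [FirstOrder.Language.BoundedFormula.Realize, hnz]
      constructor
      · intro h x
        obtain ⟨hx, hr⟩ := h x x.2
        have e := xsOf_append vs hl hvs x x.2
        rw [e] at hr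
        exact hr
      · intro h a ha
        refine ⟨ha, ?_⟩
        have e := xsOf_append vs hl hvs a ha
        rw [e]
        exact h ⟨a, ha⟩
    · intro a ha
      rw [hnz] at ha
      rw [snocFn_spec _ vs hl, codeLsnoc_encodeNat, ih (vs ++ [a]) (by simp [hl]) (fun x hx => by
        rcases List.mem_append.1 hx with hx | hx
        · exact hvs x hx
        · rw [List.mem_singleton.1 hx]; exact ha)]
      congr 1
      rw [decide_eq_decide]
      exact ⟨fun h => ⟨ha, h⟩, fun ⟨_, h⟩ => h⟩

/-- The evaluator on a SENTENCE decides `Realizes`. [Libkin 2004, Prop. 6.6] [folklore] -/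
theorem evalFn_sentence (Φ : ESOSentence ar) (R : RelTables ar n) (W : RelTables Φ.witnessArities n)
    (z : List Bool) (hzRW : z = boolPair (codeOf R) ((encodingRelTables Φ.witnessArities n).encode W))
    (hz : n ≤ z.length) : evalFn Φ.sentence (boolPair z []) = [decide (Φ.Realizes n R W)] := by
  have h := evalFn_spec (R := R) (W := W) z hzRW hz Φ.sentence [] rfl (fun _ h => (List.not_mem_nil h).elim)
  rw [show codeL [] = [] from rfl] at h
  rw [h]
  congr 1
  rw [decide_eq_decide]
  unfold RealizesB ESOSentence.Realizes FirstOrder.Language.Sentence.Realize FirstOrder.Language.Formula.Realize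
  rw [show (xsOf (n := n) ([] : List ℕ) rfl (fun _ h => (List.not_mem_nil h).elim) : Fin 0 → Fin n) = default from
    Subsingleton.elim _ _]

end Spec

/-! ### Assembly: the verifier language is in `P` -/

section Assembly

variable (ar : List ℕ)

/-- The guard bit `[|z| + 1 ≤ ⟦u⟧]` (unary-versus-binary comparison `unLeBinFn` of
`UnaryLeBinary.lean` on `⟨1 :: z, u⟩`). [folklore] -/
noncomputable def guardFn : List Bool → List Bool := unLeBinFn ∘ fanoutFn (List.cons true) uOf

/-- `guardFn ∈ FP`. [folklore] -/
theorem guardFn_mem_FP : guardFn ∈ FP :=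
  comp_mem_FP unLeBinFn_mem_FP (fanoutFn_mem_FP (cons_mem_FP true) uOf_mem_FP)

/-- The guard bit on a word with canonical numeral: `[|z| < n]`. [folklore] -/
theorem guardFn_eq {z : List Bool} (hu : norm (uOf z) = uOf z) : guardFn z = [decide (z.length + 1 ≤ nOf z)] := by
  have hu' : uOf z = encodeNat (nOf z) := by rw [nOf, ← norm_eq_encodeNat, hu]
  simp only [guardFn, Function.comp_apply, fanoutFn_apply]
  rw [hu', unLeBinFn_boolPair]
  simp

/-- The six polynomial-time tests. [folklore] -/
theorem tests_mem_P (wit : List ℕ) (E : List Bool → List Bool) (hE : E ∈ FP) :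
    ({z | rePair z = z} : Language Bool) ∈ P ∧ ({z | rePair (xOf z) = xOf z} : Language Bool) ∈ P ∧
    ({z | norm (uOf z) = uOf z} : Language Bool) ∈ P ∧ ({z | guardFn z = [false]} : Language Bool) ∈ P ∧
    ({z | (tOf z).length = (tbU ar z).length} : Language Bool) ∈ P ∧
    ({z | (yOf z).length = (tbU wit z).length} : Language Bool) ∈ P ∧
    ({z | E (boolPair z []) = [true]} : Language Bool) ∈ P := by
  refine ⟨setOf_apply_eq_apply_mem_P rePair_mem_FP OracleCompose.id_mem_FP,
    setOf_apply_eq_apply_mem_P (comp_mem_FP rePair_mem_FP xOf_mem_FP) xOf_mem_FP,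
    setOf_apply_eq_apply_mem_P (comp_mem_FP norm_mem_FP uOf_mem_FP) uOf_mem_FP,
    setOf_apply_eq_apply_mem_P guardFn_mem_FP (const_mem_FP _), ?_, ?_, ?_⟩
  · have h : ({z | (tOf z).length = (tbU ar z).length} : Language Bool) = fanoutFn (tbU ar) tOf ⁻¹' LenEq Polynomial.X := by
      ext z
      change (tOf z).length = (tbU ar z).length ↔ fanoutFn (tbU ar) tOf z ∈ LenEq Polynomial.X
      rw [fanoutFn_apply, boolPair_mem_LenEq, Polynomial.eval_X]
    rw [h]; exact preimage_mem_P (LenEq_mem_P _) (fanoutFn_mem_FP (tbU_mem_FP ar) tOf_mem_FP)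
  · have h : ({z | (yOf z).length = (tbU wit z).length} : Language Bool) = fanoutFn (tbU wit) yOf ⁻¹' LenEq Polynomial.X := by
      ext z
      change (yOf z).length = (tbU wit z).length ↔ fanoutFn (tbU wit) yOf z ∈ LenEq Polynomial.X
      rw [fanoutFn_apply, boolPair_mem_LenEq, Polynomial.eval_X]
    rw [h]; exact preimage_mem_P (LenEq_mem_P _) (fanoutFn_mem_FP (tbU_mem_FP wit) yOf_mem_FP)
  · have h : ({z | E (boolPair z []) = [true]} : Language Bool) =
        {z | (E ∘ fanoutFn id (fun _ => [])) z = (fun _ => [true]) z} := by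
      ext z; simp [fanoutFn_apply]
    rw [h]
    exact setOf_apply_eq_apply_mem_P (comp_mem_FP hE (fanoutFn_mem_FP OracleCompose.id_mem_FP (const_mem_FP _)))
      (const_mem_FP _)

variable {ar}

/-- **The verifier language is the intersection of the six tests.** [Libkin 2004, proof of
Thm. 9.6, first part (p. 170)] [folklore] -/
theorem verifierLanguage_eq (har : IsNondegenerateVocab ar) (Φ : ESOSentence ar) :
    Φ.verifierLanguage =
      (({z | rePair z = z} : Language Bool) ⊓ {z | rePair (xOf z) = xOf z} ⊓ {z | norm (uOf z) = uOf z} ⊓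
        {z | guardFn z = [false]} ⊓ {z | (tOf z).length = (tbU ar z).length} ⊓
        {z | (yOf z).length = (tbU Φ.witnessArities z).length} ⊓
        {z | evalFn Φ.sentence (boolPair z []) = [true]}) := by
  classical
  ext z
  change z ∈ Φ.verifierLanguage ↔ ((((((rePair z = z ∧ rePair (xOf z) = xOf z) ∧ norm (uOf z) = uOf z) ∧
    guardFn z = [false]) ∧ (tOf z).length = (tbU ar z).length) ∧
    (yOf z).length = (tbU Φ.witnessArities z).length) ∧ evalFn Φ.sentence (boolPair z []) = [true])
  constructor
  · rintro ⟨n, R, W, rfl, hW⟩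
    set z := boolPair ((encodingSNPInstance ar).encode ⟨n, R⟩) ((encodingRelTables Φ.witnessArities n).encode W) with hzdef
    have hzRW : z = boolPair (codeOf R) ((encodingRelTables Φ.witnessArities n).encode W) := rfl
    have hval : Valid ar Φ.witnessArities z := (valid_iff z).2 ⟨n, R, W, rfl⟩
    obtain ⟨hz, hx, hu, ht, hy⟩ := hval
    have hn : nOf z = n := (decode_boolPair n R W).2.2.2.2
    have hle : nOf z ≤ z.length := nOf_le_length har ((valid_iff z).2 ⟨n, R, W, rfl⟩)
    refine ⟨⟨⟨⟨⟨⟨hz, hx⟩, hu⟩, ?_⟩, ?_⟩, ?_⟩, ?_⟩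
    · rw [guardFn_eq hu]; simp; omega
    · rw [tbU_of_le ar hle, ht]; simp [ones]
    · rw [tbU_of_le _ hle, hy]; simp [ones]
    · rw [evalFn_sentence Φ R W z hzRW (by rw [← hn]; exact hle), decide_eq_true hW]
  · rintro ⟨⟨⟨⟨⟨⟨hz, hx⟩, hu⟩, hg⟩, ht⟩, hy⟩, he⟩
    have hle : nOf z ≤ z.length := by
      rw [guardFn_eq hu] at hg
      have := List.head_eq_of_cons_eq hg
      simp only [decide_eq_false_iff_not, not_le] at this
      omega
    rw [tbU_of_le ar hle] at ht
    rw [tbU_of_le _ hle] at hy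
    simp only [ones, List.length_replicate] at ht hy
    obtain ⟨n, R, W, hzRW⟩ := (valid_iff z).1 ⟨hz, hx, hu, ht, hy⟩
    have hn : nOf z = n := by rw [← hzRW]; exact (decode_boolPair n R W).2.2.2.2
    rw [evalFn_sentence Φ R W z hzRW.symm (by rw [← hn]; exact hle)] at he
    have hW : Φ.Realizes n R W := of_decide_eq_true (List.head_eq_of_cons_eq he)
    exact ⟨n, R, W, hzRW, hW⟩

/-- **The verifier language of every `∃SO` sentence over a non-degenerate vocabulary is in `P`**
(discharge of the named fact `ESOSentence.verifierLanguage_mem_P` of `Fagin.lean`: the data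
complexity of first-order logic is polynomial time; Libkin 2004, Prop. 6.6; Immerman 1999,
Thm. 3.1). [cite: Libkin2004, Prop. 6.6] -/
theorem ESOSentence.verifierLanguage_mem_P_holds : ESOSentence.verifierLanguage_mem_P := by
  intro ar har Φ
  rw [verifierLanguage_eq har Φ]
  obtain ⟨h1, h2, h3, h4, h5, h6, h7⟩ := tests_mem_P ar Φ.witnessArities (evalFn Φ.sentence) (evalFn_mem_FP _)
  exact inter_mem_P (inter_mem_P (inter_mem_P (inter_mem_P (inter_mem_P (inter_mem_P h1 h2) h3) h4) h5) h6) h7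

/-- Hence **Fagin's easy direction `∃SO ⊆ NP`** (discharge of `eso_subset_NP` of `Fagin.lean`).
[Libkin 2004, Thm. 9.6 (proof, first part, p. 170); Immerman 1999, Thm. 7.8] [folklore] -/
theorem eso_subset_NP_holds : eso_subset_NP :=
  eso_subset_NP_of_verifierLanguage_mem_P ESOSentence.verifierLanguage_mem_P_holds

end Assembly

end Literature.ModelTheory.FiniteModelTheory
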